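import Summits.CriticalPhenomena.CardyFormulaZ2.Theorems.CardyComplexConeParafermionToSLESixFamiliesDiamondDefsR3
import Summits.CriticalPhenomena.CardyFormulaZ2.Theorems.CardyComplexConeParafermionToSLESixFamiliesDiamondBIdLocalH
import Summits.CriticalPhenomena.CardyFormulaZ2.Theorems.CardyComplexConeParafermionToSLESixFamiliesDiamondIdentifyPolygon
import Literature.Analysis.Complex.HarmonicMaxPrincipleExceptional
import Literature.Probability.RandomPlanarGeometry.CaratheodoryHalfPlaneProofs
import Mathlib.Analysis.Complex.Harmonic.Analytic
import HarnessLib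

/-!
# Line `potential-darboux-picard-diamond`, stub S4v: `stub_boundaryIdentification` (the boundary identification `(G′)³ = c·ψ′/ψ`)

Stub file of crux `ParafermionToSLESixFamilies` (stmt-CriticalPhenomena-11389), line `potential-darboux-picard-diamond`,
registered stub `stub_boundaryIdentification : BoundaryIdentification` (S4v, the last step (v) of the identification
engine; with it the glue `identifyPotentialPh_of_boundaryIdentification` of `…DiamondDefsR3` closes S4′). PROOF
(classical complex analysis, no research input), carried out on the upper half-plane for a chordal uniformizer
`φ : ℍ → D` (`MarkedDomain.exists_isChordalUniformizing_holds`) and the function `H(u) = (G′(φ u))³ · u · φ′(u)`: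

* `H_const` (registered helper): `H` is a NON-ZERO CONSTANT on `ℍ`. Transported to the unit disc by the Cayley
  transform, `h = (H ∘ cayley⁻¹)² / κ²` is holomorphic and bounded (local exponent bounds at the break points and at
  infinity, `H_bound_near_break`, `H_bound_near_infty` of `…DiamondBIdLocalH`; continuity elsewhere; compactness of the
  closed disc, `H_bounded_disc`), and its imaginary part — a bounded harmonic function — tends to `0` at every point of
  the circle except the finitely many images of break points (`H_sq_tendsto_regular`: Schwarz reflection of `φ` and
  `G ∘ φ` across the open pieces, the squared boundary phase `κ²` being the same on all pieces); by the maximum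
  principle with exceptional points (`Literature.Analysis.Complex.harmonic_le_of_frontier_except`, Lindelöf) it
  vanishes, so `h` is a real-valued holomorphic function, hence constant (open mapping), so `H²` is constant and `H` is
  constant on the connected `ℍ` (`IsPreconnected.eq_or_eq_neg_of_sq_eq`), non-zero because `G′ ≢ 0`;
* `stub_boundaryIdentification`: the constancy of `H` is the identity `(G′ w)³ = cst · ψ′(w)/ψ(w)` on `D`
  (`deriv_cube_eq_of_H_const`, chain rule), and dilation invariance of `ψ′/ψ` (`identify_allUniformizers_of_one`,
  p138807) passes from `φ` to every chordal uniformizer.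
-/

noncomputable section

namespace Summit.CriticalPhenomena.CardyFormulaZ2.Cruxes.ParafermionToSLESixFamilies.PotentialDarbouxPicardDiamond

open scoped Topology Real ComplexConjugate
open Filter Set Metric Complex
open UpperHalfPlane (upperHalfPlaneSet isOpen_upperHalfPlaneSet)
open Literature.Probability.RandomPlanarGeometry

section Setting

variable {D : DobrushinDomain} {N : ℕ} {ℓ : ℝ → ℂ} {t : ℕ → ℝ} {G : ℂ → ℂ} {d : ℕ → ℂ} {K : Set ℂ}
  (hN : 0 < N) (hper : ∀ s : ℝ, ℓ (s + 2 * Real.pi) = ℓ s) (hrange : Set.range ℓ = frontier D.carrier)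
  (hinj : Set.InjOn ℓ (Set.Ico 0 (2 * Real.pi))) (ht0 : t 0 = 0) (htlt : ∀ j, t j < t (j + 1))
  (htper : ∀ j, t (j + N) = t j + 2 * Real.pi) (hseg : ∀ j, IsBdrySegment D (ℓ (t j)) (ℓ (t (j + 1))))
  (haff : ∀ (j : ℕ) (s : ℝ), t j ≤ s → s ≤ t (j + 1) →
    ℓ s = ℓ (t j) + (((s - t j) / (t (j + 1) - t j) : ℝ) : ℂ) * (ℓ (t (j + 1)) - ℓ (t j)))
  (hd0 : ‖d 0‖ = 1)
  (hd : ∀ j, d (j + 1) = d j * Complex.exp ((((2 / 3 : ℝ) * ((ℓ (t (j + 2)) - ℓ (t (j + 1))) /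
    (ℓ (t (j + 1)) - ℓ (t j))).arg + Real.pi / 3 * markInd D (ℓ (t (j + 1)))) : ℝ) * Complex.I))
  (harg : ∀ j, ((ℓ (t (j + 2)) - ℓ (t (j + 1))) / (ℓ (t (j + 1)) - ℓ (t j))).arg = 0 ∨
    ((ℓ (t (j + 2)) - ℓ (t (j + 1))) / (ℓ (t (j + 1)) - ℓ (t j))).arg = Real.pi / 2)
  (hθcases : ∀ j, (2 / 3 : ℝ) * ((ℓ (t (j + 2)) - ℓ (t (j + 1))) / (ℓ (t (j + 1)) - ℓ (t j))).arg +
    Real.pi / 3 * markInd D (ℓ (t (j + 1))) = Real.pi / 3 ∨ (2 / 3 : ℝ) * ((ℓ (t (j + 2)) - ℓ (t (j + 1))) /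
    (ℓ (t (j + 1)) - ℓ (t j))).arg + Real.pi / 3 * markInd D (ℓ (t (j + 1))) = 2 * Real.pi / 3)
  (hθsum : ∑ j ∈ Finset.range N, ((2 / 3 : ℝ) * ((ℓ (t (j + 2)) - ℓ (t (j + 1))) / (ℓ (t (j + 1)) - ℓ (t j))).arg +
    Real.pi / 3 * markInd D (ℓ (t (j + 1)))) = 2 * Real.pi)
  (hGc : ContinuousOn G (closure D.carrier)) (hGd : DifferentiableOn ℂ G D.carrier) (hGi : InjOn G D.carrier)
  (hK : K = convexHull ℝ (Set.range fun j => G (ℓ (t j)))) (hGim : G '' D.carrier = interior K)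
  (hmono : ∀ (j : ℕ) (s s' : ℝ), t j ≤ s → s ≤ s' → s' ≤ t (j + 1) → ∃ r : ℝ, 0 ≤ r ∧ G (ℓ s') - G (ℓ s) = r * d j)
  (φ : ConformalEquiv upperHalfPlaneSet D.carrier) {Ψ : ℂ → ℂ} (hΨc : ContinuousOn Ψ (closedBall 0 1))
  (hΨi : InjOn Ψ (closedBall 0 1)) (hΨcl : MapsTo Ψ (closedBall 0 1) (closure D.carrier))
  (hΨfr : MapsTo Ψ (sphere 0 1) (frontier D.carrier)) (hφΨ : ∀ u ∈ upperHalfPlaneSet, φ u = Ψ (cayleyFun u))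
  (hΨ0 : Ψ (cayleyFun 0) = D.pt 0) (hΨ1 : Ψ 1 = D.pt 1)

include hN hper hrange ht0 htlt htper hd0 hd hθcases hθsum hmono hK in
/-- **Interior points of the limit polygon are strictly to the left of every edge line** (`boundaryTrace_polygon`). -/
theorem strict_left : ∀ w₀ ∈ interior K, ∀ j : ℕ, 0 < ((w₀ - G (ℓ (t j))) * (starRingEnd ℂ) (d j)).im := by
  set θ : ℕ → ℝ := fun j => (2 / 3 : ℝ) * ((ℓ (t (j + 2)) - ℓ (t (j + 1))) / (ℓ (t (j + 1)) - ℓ (t j))).arg +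
    Real.pi / 3 * markInd D (ℓ (t (j + 1))) with hθdef
  have hd' : ∀ j, d (j + 1) = d j * exp (θ j * I) := hd
  have hd0ne : d 0 ≠ 0 := fun h => by rw [h, norm_zero] at hd0; exact zero_ne_one hd0
  have hπ := Real.pi_pos
  have hθ : ∀ j, 0 ≤ θ j ∧ θ j ≤ Real.pi := fun j => by
    rcases hθcases j with h | h
    · have : θ j = Real.pi / 3 := h
      rw [this]; constructor <;> linarith
    · have : θ j = 2 * Real.pi / 3 := h
      rw [this]; constructor <;> linarith
  have hvper : ∀ j, ℓ (t (j + N)) = ℓ (t j) := break_point_periodic hper htper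
  have hθper : ∀ j, θ (j + N) = θ j := fun j => by
    simp only [hθdef]
    rw [show j + N + 2 = (j + 2) + N by ring, show j + N + 1 = (j + 1) + N by ring, hvper, hvper, hvper]
  obtain ⟨-, -, -, hstrict, -⟩ := boundaryTrace_polygon D N ℓ t G d θ hN hper hrange ht0 htlt htper hd0ne hd' hθ hθper
    hθsum hmono
  rw [← hK] at hstrict
  exact hstrict

include hN hper hrange ht0 htper in
/-- **A real point is sent by `P = Ψ ∘ cayley` either to a break point or into an open piece.** -/
theorem real_point_cases (hP : ∀ x : ℝ, Ψ (cayleyFun x) ∈ frontier D.carrier) (x : ℝ) :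
    (∃ i : ℕ, 1 ≤ i ∧ i ≤ N ∧ Ψ (cayleyFun x) = ℓ (t i)) ∨
    (∃ (j : ℕ) (s : ℝ), j < N ∧ t j < s ∧ s < t (j + 1) ∧ Ψ (cayleyFun x) = ℓ s) := by
  obtain ⟨j, s, hj, h1, h2, -, hs⟩ := exists_piece_param_of_mem_frontier hN hper hrange ht0 htper (hP x)
  rcases h1.lt_or_eq with hlt1 | heq1
  · rcases h2.lt_or_eq with hlt2 | heq2
    · exact Or.inr ⟨j, s, hj, hlt1, hlt2, hs⟩
    · exact Or.inl ⟨j + 1, by omega, by omega, by rw [hs, heq2]⟩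
  · rcases Nat.eq_zero_or_pos j with hj0 | hjpos
    · refine Or.inl ⟨N, hN, le_rfl, ?_⟩
      rw [hs, ← heq1, hj0, show N = 0 + N from (zero_add N).symm, break_point_periodic hper htper 0]
    · exact Or.inl ⟨j, hjpos, hj.le, by rw [hs, heq1]⟩

include hN hper hrange hinj ht0 htlt htper hseg haff hd0 hd harg hθcases hθsum hGc hGd hK hGim hmono hΨc hΨi hΨcl hΨfr hφΨ
  hΨ0 hΨ1 in
/-- **`H` is bounded near every real point.** -/
theorem H_locally_bounded_real (x : ℝ) : ∃ C ρ : ℝ, 0 < ρ ∧ ∀ u ∈ upperHalfPlaneSet, dist u x < ρ →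
    ‖deriv G (φ u) ^ 3 * u * deriv φ u‖ ≤ C := by
  have hstrict := strict_left hN hper hrange ht0 htlt htper hd0 hd hθcases hθsum hK hmono
  have hP : ∀ x : ℝ, Ψ (cayleyFun x) ∈ frontier D.carrier := fun x => hΨfr (cayleyFun_mem_sphere (by simp))
  rcases real_point_cases hN hper hrange ht0 htper hP x with ⟨i, hi1, hiN, hx⟩ | ⟨j, s, hj, hs1, hs2, hx⟩
  · exact H_bound_near_break D N ℓ t G d K hN hper hrange hinj ht0 htlt htper hseg haff hd0 hd harg hθcases hGc hGd hGim
      hstrict hmono φ Ψ hΨc hΨi hΨcl hΨfr hφΨ hΨ0 hΨ1 x i hi1 hiN hx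
  · obtain ⟨ρ, -, hT⟩ := H_sq_tendsto_regular D N ℓ t G d K hN hper hrange hinj ht0 htlt htper hseg haff hd0 hd hGc hGd
      hGim hstrict hmono φ Ψ hΨc hΨcl hΨfr hφΨ hΨ0 x j hj s hs1 hs2 hx
    set L : ℂ := (ρ : ℂ) * (d 0 ^ 3 / ((ℓ (t 1) - ℓ (t 0)) / (‖ℓ (t 1) - ℓ (t 0)‖ : ℂ)) ^ 2) ^ 2
    have hev : ∀ᶠ u in 𝓝[upperHalfPlaneSet] (x : ℂ), ‖(deriv G (φ u) ^ 3 * u * deriv φ u) ^ 2‖ < ‖L‖ + 1 := by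
      have := (continuous_norm.tendsto L).comp hT
      exact this.eventually (Iio_mem_nhds (by linarith))
    obtain ⟨ρ', hρ', hball⟩ := Metric.mem_nhdsWithin_iff.1 hev
    refine ⟨max 1 (‖L‖ + 1), ρ', hρ', fun u hu hdist => ?_⟩
    have h := hball ⟨hdist, hu⟩
    simp only [mem_setOf_eq, norm_pow] at h
    set a := ‖deriv G (φ u) ^ 3 * u * deriv φ u‖
    by_cases ha : a ≤ 1
    · exact ha.trans (le_max_left _ _)
    · push Not at ha
      have : a ≤ a ^ 2 := by nlinarith
      exact (this.trans h.le).trans (le_max_right _ _)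

include hN hper hrange hinj ht0 htlt htper hseg haff hd0 hd harg hθcases hθsum hGc hGd hK hGim hmono hΨc hΨi hΨcl hΨfr hφΨ
  hΨ0 hΨ1 in
/-- **`H ∘ cayley⁻¹` is bounded on the unit disc** (local bounds and compactness of the closed disc). -/
theorem H_bounded_disc : ∃ B : ℝ, ∀ ζ ∈ ball (0:ℂ) 1,
    ‖deriv G (φ (cayleyInvFun ζ)) ^ 3 * cayleyInvFun ζ * deriv φ (cayleyInvFun ζ)‖ ≤ B := by
  set Hf : ℂ → ℂ := fun u => deriv G (φ u) ^ 3 * u * deriv φ u with hHf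
  have hHd : DifferentiableOn ℂ Hf upperHalfPlaneSet := differentiableOn_H φ hGd
  have hCinv : ∀ ζ ∈ ball (0:ℂ) 1, cayleyInvFun ζ ∈ upperHalfPlaneSet := fun ζ hζ => cayley.symm_mapsTo hζ
  have hCc : ∀ ζ : ℂ, ζ ≠ 1 → ContinuousAt cayleyInvFun ζ := fun ζ hζ =>
    differentiableOn_cayleyInvFun.continuousOn.continuousAt (isOpen_ne.mem_nhds hζ)
  -- local boundedness at every point of the closed disc
  have LB : ∀ ζ₀ ∈ closedBall (0:ℂ) 1, ∃ O ∈ 𝓝 ζ₀, ∃ M : ℝ, ∀ ζ ∈ O, ζ ∈ ball (0:ℂ) 1 → ‖Hf (cayleyInvFun ζ)‖ ≤ M := by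
    intro ζ₀ hζ₀
    by_cases hin : ζ₀ ∈ ball (0:ℂ) 1
    · -- interior point: continuity
      have hcont : ContinuousAt (fun ζ => Hf (cayleyInvFun ζ)) ζ₀ := by
        have h1 : ContinuousOn (fun ζ => Hf (cayleyInvFun ζ)) (ball 0 1) :=
          hHd.continuousOn.comp cayley.symm.continuousOn (fun ζ hζ => hCinv ζ hζ)
        exact h1.continuousAt (isOpen_ball.mem_nhds hin)
      have hev : ∀ᶠ ζ in 𝓝 ζ₀, ‖Hf (cayleyInvFun ζ)‖ < ‖Hf (cayleyInvFun ζ₀)‖ + 1 := by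
        have h := (continuous_norm.continuousAt.comp hcont).eventually
          (Iio_mem_nhds (show ‖Hf (cayleyInvFun ζ₀)‖ < ‖Hf (cayleyInvFun ζ₀)‖ + 1 by linarith))
        exact h
      exact ⟨_, hev, _, fun ζ hζ _ => le_of_lt hζ⟩
    · have hnorm : ‖ζ₀‖ = 1 := le_antisymm (mem_closedBall_zero_iff.1 hζ₀) (not_lt.1 (fun h => hin (mem_ball_zero_iff.2 h)))
      by_cases h1 : ζ₀ = 1
      · -- the point at infinity
        subst h1
        obtain ⟨C, R, -, hb⟩ := H_bound_near_infty D N ℓ t G d K hN hper hrange hinj ht0 htlt htper hseg haff hd0 hd harg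
          hθcases hGc hGd hGim (strict_left hN hper hrange ht0 htlt htper hd0 hd hθcases hθsum hK hmono) hmono φ Ψ hΨc hΨi
          hΨcl hΨfr hφΨ hΨ0 hΨ1
        have hev : ∀ᶠ ζ in 𝓝[≠] (1:ℂ), R < ‖cayleyInvFun ζ‖ := by
          have hmem : {u : ℂ | R < ‖u‖} ∈ cocompact ℂ := by
            rw [Filter.mem_cocompact]
            exact ⟨closedBall 0 R, isCompact_closedBall 0 R, fun u hu => by
              simp only [mem_compl_iff, mem_closedBall_zero_iff, not_le] at hu; exact hu⟩
          exact tendsto_cayleyInvFun_nhdsNE_one hmem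
        have hO : {ζ : ℂ | ζ ∈ ({1}ᶜ : Set ℂ) → R < ‖cayleyInvFun ζ‖} ∈ 𝓝 (1:ℂ) := eventually_nhdsWithin_iff.1 hev
        refine ⟨_, hO, C, fun ζ hζ hζb => ?_⟩
        have hζ1 : ζ ≠ 1 := by rintro rfl; simp at hζb
        exact hb _ (hCinv ζ hζb) (hζ hζ1)
      · -- a finite boundary point
        set x : ℝ := (cayleyInvFun ζ₀).re with hx
        have hcx : cayleyFun x = ζ₀ := by rw [hx, ← cayleyInvFun_eq_ofReal_re hnorm, cayleyFun_cayleyInvFun h1]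
        have hCx : cayleyInvFun ζ₀ = x := by rw [hx]; exact cayleyInvFun_eq_ofReal_re hnorm
        obtain ⟨C, ρ, hρ, hb⟩ := H_locally_bounded_real hN hper hrange hinj ht0 htlt htper hseg haff hd0 hd harg hθcases hθsum
          hGc hGd hK hGim hmono φ hΨc hΨi hΨcl hΨfr hφΨ hΨ0 hΨ1 x
        have hO : cayleyInvFun ⁻¹' ball (x : ℂ) ρ ∈ 𝓝 ζ₀ := (hCc ζ₀ h1).preimage_mem_nhds (by rw [hCx]; exact ball_mem_nhds _ hρ)
        exact ⟨_, hO, C, fun ζ hζ hζb => hb _ (hCinv ζ hζb) (mem_ball.1 hζ)⟩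
  choose! O hO M hM using LB
  obtain ⟨T, hTsub, hcover⟩ := (isCompact_closedBall (0:ℂ) 1).elim_nhds_subcover O hO
  refine ⟨∑ z ∈ T, |M z|, fun ζ hζ => ?_⟩
  obtain ⟨z, hzT, hζz⟩ := mem_iUnion₂.1 (hcover (ball_subset_closedBall hζ))
  calc ‖Hf (cayleyInvFun ζ)‖ ≤ M z := hM z (hTsub z hzT) ζ hζz hζ
    _ ≤ |M z| := le_abs_self _
    _ ≤ ∑ z ∈ T, |M z| := Finset.single_le_sum (f := fun z => |M z|) (fun _ _ => abs_nonneg _) hzT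

include hN hper hrange hinj ht0 htlt htper hseg haff hd0 hd harg hθcases hθsum hGc hGd hGi hK hGim hmono hΨc hΨi hΨcl hΨfr
  hφΨ hΨ0 hΨ1 in
/-- **`H` is a non-zero constant on `ℍ`** (see the module docstring). -/
theorem H_const_of_extension : ∃ cst : ℂ, cst ≠ 0 ∧ ∀ u ∈ upperHalfPlaneSet, deriv G (φ u) ^ 3 * u * deriv φ u = cst := by
  classical
  have hstrict := strict_left hN hper hrange ht0 htlt htper hd0 hd hθcases hθsum hK hmono
  have hne : ∀ j, ℓ (t j) ≠ ℓ (t (j + 1)) := fun j => (hseg j).1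
  set Hf : ℂ → ℂ := fun u => deriv G (φ u) ^ 3 * u * deriv φ u with hHf
  have hHd : DifferentiableOn ℂ Hf upperHalfPlaneSet := differentiableOn_H φ hGd
  -- the common squared boundary phase
  set κsq : ℂ := (d 0 ^ 3 / ((ℓ (t 1) - ℓ (t 0)) / (‖ℓ (t 1) - ℓ (t 0)‖ : ℂ)) ^ 2) ^ 2 with hκsq
  have hu0n : ‖(ℓ (t 1) - ℓ (t 0)) / (‖ℓ (t 1) - ℓ (t 0)‖ : ℂ)‖ = 1 := norm_unitDir (hne 0)
  have hκn : ‖κsq‖ = 1 := by rw [hκsq, norm_pow, norm_div, norm_pow, norm_pow, hd0, hu0n]; norm_num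
  have hκ0 : κsq ≠ 0 := fun h => by rw [h, norm_zero] at hκn; exact zero_ne_one hκn
  -- the function on the disc
  set h : ℂ → ℂ := fun ζ => Hf (cayleyInvFun ζ) ^ 2 / κsq with hh
  have hCinv : ∀ ζ ∈ ball (0:ℂ) 1, cayleyInvFun ζ ∈ upperHalfPlaneSet := fun ζ hζ => cayley.symm_mapsTo hζ
  have hhd : DifferentiableOn ℂ h (ball 0 1) :=
    ((hHd.comp cayley.symm.differentiableOn fun ζ hζ => hCinv ζ hζ).pow 2).div_const _
  have hhan : AnalyticOnNhd ℂ h (ball 0 1) := hhd.analyticOnNhd isOpen_ball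
  set v : ℂ → ℝ := fun ζ => (h ζ).im with hv
  have hvh : InnerProductSpace.HarmonicOnNhd v (ball (0:ℂ) 1) := fun ζ hζ => (hhan ζ hζ).harmonicAt_im
  -- boundedness
  obtain ⟨B, hB⟩ := H_bounded_disc hN hper hrange hinj ht0 htlt htper hseg haff hd0 hd harg hθcases hθsum hGc hGd hK hGim
    hmono φ hΨc hΨi hΨcl hΨfr hφΨ hΨ0 hΨ1
  have hvB : ∀ ζ ∈ ball (0:ℂ) 1, |v ζ| ≤ B ^ 2 := by
    intro ζ hζ
    have h1 : |v ζ| ≤ ‖h ζ‖ := abs_im_le_norm _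
    have h2 : ‖h ζ‖ = ‖Hf (cayleyInvFun ζ)‖ ^ 2 := by simp only [hh]; rw [norm_div, norm_pow, hκn, div_one]
    have h3 : ‖Hf (cayleyInvFun ζ)‖ ^ 2 ≤ B ^ 2 := pow_le_pow_left₀ (norm_nonneg _) (hB ζ hζ) 2
    linarith
  -- the exceptional set
  have hP : ∀ x : ℝ, Ψ (cayleyFun x) ∈ frontier D.carrier := fun x => hΨfr (cayleyFun_mem_sphere (by simp))
  set Bk : Set ℝ := (fun x : ℝ => Ψ (cayleyFun x)) ⁻¹' ((fun i : ℕ => ℓ (t i)) '' Set.Icc 1 N) with hBk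
  have hBkfin : Bk.Finite := by
    refine Set.Finite.preimage (fun x _ y _ hxy => ?_) ((Set.finite_Icc 1 N).image _)
    have := injOn_extP hΨi (show (x : ℂ) ∈ {u : ℂ | 0 ≤ u.im} by simp) (show (y : ℂ) ∈ {u : ℂ | 0 ≤ u.im} by simp) hxy
    exact_mod_cast this
  set E : Finset ℂ := (hBkfin.image fun x : ℝ => cayleyFun x).toFinset ∪ {1} with hE
  have hEout : ∀ p ∈ E, p ∉ ball (0:ℂ) 1 := by
    intro p hp
    simp only [hE, Finset.mem_union, Set.Finite.mem_toFinset, mem_image, Finset.mem_singleton] at hp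
    rcases hp with ⟨x, -, rfl⟩ | rfl
    · rw [mem_ball_zero_iff, norm_cayleyFun_ofReal]; exact lt_irrefl _
    · simp
  -- boundary limits off the exceptional set
  have hbdry : ∀ ζ ∈ frontier (ball (0:ℂ) 1), ζ ∉ E → Tendsto v (𝓝[ball (0:ℂ) 1] ζ) (𝓝 0) := by
    intro ζ hζ hζE
    rw [frontier_ball (0:ℂ) one_ne_zero, mem_sphere_zero_iff_norm] at hζ
    have hζ1 : ζ ≠ 1 := fun h1 => hζE (by simp [hE, h1])
    set x : ℝ := (cayleyInvFun ζ).re with hx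
    have hcx : cayleyFun x = ζ := by rw [hx, ← cayleyInvFun_eq_ofReal_re hζ, cayleyFun_cayleyInvFun hζ1]
    have hCx : cayleyInvFun ζ = x := by rw [hx]; exact cayleyInvFun_eq_ofReal_re hζ
    have hxB : x ∉ Bk := fun hxB => hζE (by
      simp only [hE, Finset.mem_union, Set.Finite.mem_toFinset, mem_image]
      exact Or.inl ⟨x, hxB, hcx⟩)
    -- `x` is a regular point
    obtain ⟨j, s, hj, hs1, hs2, hxs⟩ : ∃ (j : ℕ) (s : ℝ), j < N ∧ t j < s ∧ s < t (j + 1) ∧ Ψ (cayleyFun x) = ℓ s := by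
      rcases real_point_cases hN hper hrange ht0 htper hP x with ⟨i, hi1, hiN, hxi⟩ | h
      · exact absurd (show x ∈ Bk from ⟨i, ⟨hi1, hiN⟩, hxi.symm⟩) hxB
      · exact h
    obtain ⟨ρ, -, hT⟩ := H_sq_tendsto_regular D N ℓ t G d K hN hper hrange hinj ht0 htlt htper hseg haff hd0 hd hGc hGd
      hGim hstrict hmono φ Ψ hΨc hΨcl hΨfr hφΨ hΨ0 x j hj s hs1 hs2 hxs
    -- transport along `cayleyInvFun`
    have hC : Tendsto cayleyInvFun (𝓝[ball (0:ℂ) 1] ζ) (𝓝[upperHalfPlaneSet] (x : ℂ)) := by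
      refine tendsto_nhdsWithin_iff.2 ⟨?_, eventually_nhdsWithin_of_forall fun z hz => hCinv z hz⟩
      have := (differentiableOn_cayleyInvFun.continuousOn.continuousAt (isOpen_ne.mem_nhds hζ1)).tendsto
      rw [hCx] at this
      exact this.mono_left nhdsWithin_le_nhds
    have h1 : Tendsto (fun z => h z) (𝓝[ball (0:ℂ) 1] ζ) (𝓝 ((ρ : ℂ) * κsq / κsq)) := (hT.comp hC).div_const κsq
    rw [mul_div_assoc, div_self hκ0, mul_one] at h1
    have h2 := (continuous_im.tendsto _).comp h1
    rw [ofReal_im] at h2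
    exact h2
  -- the maximum principle, twice
  have hU : IsPreconnected (ball (0:ℂ) 1) := (convex_ball 0 1).isPreconnected
  have hv0 : ∀ ζ ∈ ball (0:ℂ) 1, v ζ = 0 := by
    have hle : ∀ ζ ∈ ball (0:ℂ) 1, v ζ ≤ 0 := by
      refine Literature.Analysis.Complex.harmonic_le_of_frontier_except isOpen_ball hU isBounded_ball hvh
        (B := B ^ 2) (fun ζ hζ => (abs_le.1 (hvB ζ hζ)).2) E hEout ?_
      intro ζ hζ hζE ε hε
      filter_upwards [(hbdry ζ hζ hζE).eventually (Iio_mem_nhds hε)] with z hz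
      linarith [hz.le]
    have hge : ∀ ζ ∈ ball (0:ℂ) 1, -v ζ ≤ 0 := by
      have hvh' : InnerProductSpace.HarmonicOnNhd (fun ζ => -v ζ) (ball (0:ℂ) 1) := fun ζ hζ => (hvh ζ hζ).neg
      refine Literature.Analysis.Complex.harmonic_le_of_frontier_except isOpen_ball hU isBounded_ball hvh'
        (B := B ^ 2) (fun ζ hζ => by linarith [(abs_le.1 (hvB ζ hζ)).1]) E hEout ?_
      intro ζ hζ hζE ε hε
      filter_upwards [(hbdry ζ hζ hζE).eventually (Ioi_mem_nhds (show (-ε) < 0 by linarith))] with z hz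
      have : -ε < v z := hz
      linarith
    intro ζ hζ
    linarith [hle ζ hζ, hge ζ hζ]
  -- `h` is constant on the disc
  obtain ⟨w, hw⟩ : ∃ w : ℂ, ∀ ζ ∈ ball (0:ℂ) 1, h ζ = w := by
    rcases hhan.is_constant_or_isOpen hU with hc | hopen
    · exact hc
    · exfalso
      have himg : IsOpen (h '' ball (0:ℂ) 1) := hopen _ Subset.rfl isOpen_ball
      have hmem : h 0 ∈ h '' ball (0:ℂ) 1 := mem_image_of_mem h (mem_ball_self one_pos)
      obtain ⟨ε, hε, hball⟩ := Metric.isOpen_iff.1 himg _ hmem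
      have hpt : h 0 + ((ε / 2 : ℝ) : ℂ) * I ∈ h '' ball (0:ℂ) 1 := hball (by
        rw [mem_ball, dist_eq_norm, add_sub_cancel_left, norm_mul, norm_real, norm_I, mul_one, Real.norm_eq_abs,
          abs_of_pos (by linarith)]
        linarith)
      obtain ⟨ζ, hζ, hζeq⟩ := hpt
      have him0 : (h ζ).im = 0 := hv0 ζ hζ
      have him0' : (h 0).im = 0 := hv0 0 (mem_ball_self one_pos)
      rw [hζeq] at him0
      simp [him0'] at him0
      linarith
  -- hence `H²` is constant on `ℍ`
  have hsq : ∀ u ∈ upperHalfPlaneSet, Hf u ^ 2 = w * κsq := by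
    intro u hu
    have h1 : cayleyFun u ∈ ball (0:ℂ) 1 := cayley.mapsTo hu
    have h2 : cayleyInvFun (cayleyFun u) = u := cayleyInvFun_cayleyFun (add_I_ne_zero (le_of_lt hu))
    have := hw _ h1
    simp only [hh, h2] at this
    rw [← this, div_mul_cancel₀ _ hκ0]
  -- and `H` is constant on the connected `ℍ`
  obtain ⟨u₀, hu₀, hH₀⟩ := exists_H_ne_zero φ hGd hGi
  have hpre : IsPreconnected upperHalfPlaneSet := (convex_halfSpace_im_gt 0).isPreconnected
  have hsqeq : EqOn (Hf ^ 2) ((fun _ => Hf u₀) ^ 2) upperHalfPlaneSet := fun u hu => by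
    simp only [Pi.pow_apply]
    rw [hsq u hu, hsq u₀ hu₀]
  rcases hpre.eq_or_eq_neg_of_sq_eq hHd.continuousOn continuousOn_const hsqeq (fun _ => hH₀) with heq | heq
  · exact ⟨Hf u₀, hH₀, fun u hu => heq hu⟩
  · exact ⟨-Hf u₀, neg_ne_zero.2 hH₀, fun u hu => heq hu⟩

end Setting

/-- **`H` IS A NON-ZERO CONSTANT** (registered helper; conclusion of step (v) on the half-plane): for every chordal
uniformizer `φ` of a marked diamond with its boundary chain and every conformal map `G` of the diamond onto the interior of
the limit hexagon following the TURN rule, `(G′(φ u))³ · u · φ′(u)` is a non-zero constant on `ℍ`. -/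
theorem H_const : ∀ (D : DobrushinDomain) (N : ℕ) (ℓ : ℝ → ℂ) (t : ℕ → ℝ) (G : ℂ → ℂ) (d : ℕ → ℂ) (K : Set ℂ), 0 < N → (∀ s : ℝ, ℓ (s + 2 * Real.pi) = ℓ s) → Set.range ℓ = frontier D.carrier → Set.InjOn ℓ (Set.Ico 0 (2 * Real.pi)) → t 0 = 0 → (∀ j, t j < t (j + 1)) → (∀ j, t (j + N) = t j + 2 * Real.pi) → (∀ j, IsBdrySegment D (ℓ (t j)) (ℓ (t (j + 1)))) → (∀ (j : ℕ) (s : ℝ), t j ≤ s → s ≤ t (j + 1) → ℓ s = ℓ (t j) + (((s - t j) / (t (j + 1) - t j) : ℝ) : ℂ) * (ℓ (t (j + 1)) - ℓ (t j))) → ‖d 0‖ = 1 → (∀ j, d (j + 1) = d j * Complex.exp ((((2 / 3 : ℝ) * ((ℓ (t (j + 2)) - ℓ (t (j + 1))) / (ℓ (t (j + 1)) - ℓ (t j))).arg + Real.pi / 3 * markInd D (ℓ (t (j + 1)))) : ℝ) * Complex.I)) → (∀ j, ((ℓ (t (j + 2)) - ℓ (t (j + 1))) / (ℓ (t (j + 1))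 - ℓ (t j))).arg = 0 ∨ ((ℓ (t (j + 2)) - ℓ (t (j + 1))) / (ℓ (t (j + 1)) - ℓ (t j))).arg = Real.pi / 2) → (∀ j, (2 / 3 : ℝ) * ((ℓ (t (j + 2)) - ℓ (t (j + 1))) / (ℓ (t (j + 1)) - ℓ (t j))).arg + Real.pi / 3 * markInd D (ℓ (t (j + 1))) = Real.pi / 3 ∨ (2 / 3 : ℝ) * ((ℓ (t (j + 2)) - ℓ (t (j + 1))) / (ℓ (t (j + 1)) - ℓ (t j))).arg + Real.pi / 3 * markInd D (ℓ (t (j + 1))) = 2 * Real.pi / 3) → ∑ j ∈ Finset.range N, ((2 / 3 : ℝ) * ((ℓ (t (j + 2)) - ℓ (t (j + 1))) / (ℓ (t (j + 1)) - ℓ (t j))).arg + Real.pi / 3 * markInd D (ℓ (t (j + 1)))) = 2 * Real.pi → ContinuousOn G (closure D.carrier) → DifferentiableOn ℂ G D.carrier → Set.InjOn G D.carrier → K = convexHull ℝ (Set.range fun j => G (ℓ (t j))) → G '' D.carrier = interior K → (∀ (j : ℕ) (s s' : ℝ), t j ≤ s → s ≤ s' → s' ≤ t (j + 1) → ∃ r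 : ℝ, 0 ≤ r ∧ G (ℓ s') - G (ℓ s) = r * d j) → ∀ φ : ConformalEquiv upperHalfPlaneSet D.carrier, D.IsChordalUniformizing φ → ∃ cst : ℂ, cst ≠ 0 ∧ ∀ u ∈ upperHalfPlaneSet, deriv G (φ u) ^ 3 * u * deriv φ u = cst := by
  intro D N ℓ t G d K hN hper hrange hinj ht0 htlt htper hseg haff hd0 hd harg hθcases hθsum hGc hGd hGi hK hGim hmono φ hφ
  obtain ⟨Ψ, hΨc, hΨi, hΨcl, hΨfr, hφΨ, hΨ0, hΨ1⟩ := uniformizer_extension D φ hφ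
  exact H_const_of_extension hN hper hrange hinj ht0 htlt htper hseg haff hd0 hd harg hθcases hθsum hGc hGd hGi hK hGim hmono φ
    hΨc hΨi hΨcl hΨfr hφΨ hΨ0 hΨ1

/-! ## The stub -/

/-- **S4v — THE BOUNDARY IDENTIFICATION `(G′)³ = cst · ψ′/ψ`** (registered stub of the line; see the module
docstring for the proof). -/
theorem stub_boundaryIdentification : BoundaryIdentification := by
  intro D _hD N ℓ t G d K hN hℓc hper hrange hinj ht0 htlt htper hseg haff hd0 hd harg hargsum hθcases hθsum hGc hGhol hGinj
    hK hKc hKconv hint hGim hKfr hmono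
  obtain ⟨φ₀, hφ₀⟩ := MarkedDomain.exists_isChordalUniformizing_holds D
  obtain ⟨cst, hcst, hH⟩ := H_const D N ℓ t G d K hN hper hrange hinj ht0 htlt htper hseg haff hd0 hd harg hθcases hθsum hGc
    hGhol hGinj hK hGim hmono φ₀ hφ₀
  exact ⟨cst, hcst, identify_allUniformizers_of_one D G cst φ₀ hφ₀ (deriv_cube_eq_of_H_const φ₀ hH)⟩

end Summit.CriticalPhenomena.CardyFormulaZ2.Cruxes.ParafermionToSLESixFamilies.PotentialDarbouxPicardDiamond

end
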